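import Literature.MathematicalPhysics.QuantumFieldTheory.Balaban1983to89.B15Eq177ValueInvariance
import Literature.MathematicalPhysics.QuantumFieldTheory.Balaban1983to89.Node00.LargeFieldBackgroundCoPOfRecord

/-!
# `Balaban1983to89.B15Prop1ValueOfAnyMinimiser` — [Balaban1989LargeFieldI] = «[IV]», (1.74) p. 192, (1.77) p. 194, Prop. 1 p. 194 (last clause);
# [Balaban1988Convergent] = «[III]», (2.12) p. 256; [Balaban1985Variational] = «[15]», Prop. 9 (190) p. 309:
# THE FUNCTION (1.77) `V_k ↦ A(U_{k,Z}(V_k))` IS THE VALUE FUNCTION OF THE (2.12) PROBLEM — `A(U_{k,Z}(V_k)) = A(U′)` FOR EVERY MINIMAL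
# CONFIGURATION `U′` OF THE DATUM OF `V_k` — at r12's generic solution datum `DetBackground`, at NODE 00's totalised solution map of record
# `Node00.bgOfRecord`, and at NODE 00's (2.12) data of record on a support `Node00.bgMSCoPOfRecordAt` ∕ `Node00.bgMSCoPOfRecord`

Honest framing: statement-level bookkeeping of published definitions with citation tags, fully proved; nothing here is a claim about the
Yang–Mills mass gap.  Cell `pub-ymgap`, HUMAN RULING D-0149 (width seats), seat `pub-ymgap-dag-n12-w1` (N12 = [B15], W-SEAT-START-LIST v2 §N12
item 1 = U1a); count-neutral; N12 NOT discharged; finite 𝕋⁴ at fixed ε; nothing continuum ∕ OS ∕ mass-gap ∕ Clay.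

WHY (LOCATED-SELECTOR, bus 2026-08-27 [DAGN12W1-G0]).  The N12∕s1 endpoints for Proposition 1 [IV] at print's (1.74) object
(`B15Prop1Thm1GeneralFormShapes` §4, p556967) carry the analytic letter (J1) `hGj`: the function
`(p, B′) ↦ A(U_{k,Z}(exp(iB′)·ext(exp(ip)V_k)))` is the real trace of ONE ℂ-differentiable bounded `𝒢` on a sup-ball — print's last clause of
Prop. 1 ∕ [Balaban1989LargeFieldII] p. 359, whose source is [15] Prop. 9 (190): *«The minimal configuration U_k(V) … has an extension to an
analytic function of Gᶜ-valued small configurations V′»*.  The natural configuration-level supplier (J0) would assert the same for the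
BACKGROUND `U_{k,Z}(·) = bgKZstd bg M₁ Z k ·` itself.  At NODE 00's objects `bg := Node00.bgMSCoPOfRecord F N ν K k Ω` the map
`bg.U = Node00.UminOfRecord …` is a TOTALISED SELECTION (`Classical.choose`, through an arbitrary admissible measurable selector when one exists)
from the (2.12) minimal SET — [III] p. 256, verbatim: *«A regular configuration V on 𝔅 determines the minimal orbit, i.e., the set of minima …
A minimal configuration, i.e., an element of the unique minimal orbit, is denoted by U_𝔅(V)»*; `B15DeterminingSets.IsMinimizer` carries no
gauge-fixing clause — so a letter equating a holomorphic family with THAT selection on real data is neither provable nor refutable for the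
object of record.  What every consumer needs is only the VALUE: this module proves that (1.77) `fun177std bg M₁ Z k V_k = A(bg.U(𝐁_k(Z),
M˙(Q_k^{s*}V_k)))` equals `A(U′)` for EVERY minimal configuration `U′` of the same datum (two minimisers of one problem have one action —
`B15Eq177ValueInvariance.wilsonAction4_eq_of_isMinimizer`, dag-n12-c g6), so that the INTRINSIC configuration letter (J0′) «SOME holomorphic
family OF MINIMISERS» (exactly print's (190) object, a specific gauge-fixed selection) feeds (J1) verbatim; and it records the junk branch
(no minimiser ⇒ `A(U_{k,Z}(V_k)) = A(1) = 0`), which is why any inhabitation of (J1) needs solvability on the whole real ball ([15] Thm 1).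

CONTENTS (theorems only; no `def`, no `instance`, no `sorry`; axioms standard).
* §1 generic `bg : DetBackground P G av` (datum in `bg.dom`): `fun177_eq_wilsonAction4_of_isMinimizer`, `fun177std_eq_wilsonAction4_of_isMinimizer`,
  `fun177std_eq_fun177std_of_isMinimizer` (two solution data with a common minimiser give one value).
* §2 NODE 00's totalised map `Node00.bgOfRecord av reg` (`dom = solvableDom`, inhabited by `U′` itself): `fun177_bgOfRecord_eq_wilsonAction4_of_isMinimizer`,
  ★ `fun177std_bgOfRecord_eq_wilsonAction4_of_isMinimizer`, `fun177std_bgOfRecord_of_not_solvable` (junk branch `= 0`),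
  `fun177std_bgOfRecord_eq_of_isMinimizer_iff` (equal (2.12) predicates ⇒ equal values, both branches).
* §3 NODE 00's data of record on a support, every `SU(N)`: ★ `fun177std_bgMSCoPOfRecordAt_eq_wilsonAction4_of_isMinimizer`,
  ★★ `fun177std_bgMSCoPOfRecord_eq_wilsonAction4_of_isMinimizer`, `fun177std_bgMSCoPOfRecord_of_not_solvable`.
* §4 the letter bridge in quantifier shape: ★★ `valueFamily_of_minimiserFamily` — from «a family `Ũ x` of configurations read in a target `𝕄`
  through `ρ`, agreeing at every real parameter `x` with SOME minimiser `U′ x` of the datum of `cfg x`» to «… agreeing with a configuration whose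
  ACTION is (1.77) at `cfg x`», for an arbitrary parameter type, reading `ρ : G → 𝕄` and configuration family `cfg` (the chart family
  `(p,B′) ↦ exp(iB′)·ext(exp(ip)V_k)` of the N12 endpoints is one instance; no chart import here).
-/

noncomputable section

namespace Literature.MathematicalPhysics.QuantumFieldTheory.Balaban1983to89.B15Prop1ValueOfAnyMinimiser

open Literature.MathematicalPhysics.QuantumFieldTheory.Balaban1983to89
open B15DeterminingSets B14.Eq213DetSet B14.Eq216Concrete GaugeField B15Sect1Instances B15Eq177ValueInvariance Node00
open Literature.MathematicalPhysics.QuantumFieldTheory.BalabanImbrieJaffe1984to88.BIJ85Eq453GaugeField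

variable {P : Params} {G : Type*} [GaugeGroup G]

/-! ## §1  Generic solution datum: (1.77) is the value of the (2.12) problem -/

section Generic

variable {av : ∀ j, Averaging P j G} (bg : DetBackground P G av)

/-- **(1.77) IS THE VALUE FUNCTION** (r12's parametrised form `fun177`): for a datum `M˙(Q^{s}V_k)` in the domain of the solution map `U(𝔹, ·)`
and ANY minimal configuration `U′` of the (2.12) problem for `(𝔹, M˙(Q^{s}V_k))`, `A(U(𝔹, M˙(Q^{s}V_k))) = A(U′)` — both are minimisers of one
problem. [cite: Balaban1989LargeFieldI, (1.77) p.194; Balaban1988Convergent, (2.12) p.256] -/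
theorem fun177_eq_wilsonAction4_of_isMinimizer {k : ℕ} (BkZ : DetSet P) (Qs : GaugeField P k G → GaugeField P 0 G)
    {Vk : GaugeField P k G} {U' : GaugeField P 0 G} (hdom : avgFamily av (Qs Vk) ∈ bg.dom BkZ)
    (hU' : IsMinimizer av bg.reg BkZ (avgFamily av (Qs Vk)) U') : fun177 bg BkZ Qs Vk = wilsonAction4 U' :=
  wilsonAction4_eq_of_isMinimizer av (bg.isMinimizer BkZ _ hdom) hU'

/-- **(1.77) AT PRINT'S INSTANCE IS THE VALUE FUNCTION**: `A(U_{k,Z}(V_k)) = A(U′)` for every minimal configuration `U′` of the (2.12)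
problem for `(𝐁_k(Z), M˙(Q_k^{s*}V_k))`, the datum lying in the domain of `U(𝐁_k(Z), ·)`. [cite: Balaban1989LargeFieldI, (1.74) p.192, (1.77) p.194; Balaban1988Convergent, (2.12) p.256] -/
theorem fun177std_eq_wilsonAction4_of_isMinimizer (M₁ : ℕ) (Z : Set (Site P 0)) (k : ℕ) {Vk : GaugeField P k G}
    {U' : GaugeField P 0 G} (hdom : avgFamily av (qsstarGIter0 k Vk) ∈ bg.dom (Bj M₁ Z k))
    (hU' : IsMinimizer av bg.reg (Bj M₁ Z k) (avgFamily av (qsstarGIter0 k Vk)) U') :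
    fun177std bg M₁ Z k Vk = wilsonAction4 U' :=
  fun177_eq_wilsonAction4_of_isMinimizer bg (Bj M₁ Z k) (qsstarGIter0 k) hdom hU'

/-- Two solution data `bg`, `bg′` over one averaging with one regularity class give ONE value of (1.77) at every `V_k` whose datum lies in both
domains (each solution map returns a minimiser of the same problem). [cite: Balaban1989LargeFieldI, (1.77) p.194; Balaban1988Convergent, (2.12) p.256] -/
theorem fun177std_eq_fun177std_of_reg_eq (bg' : DetBackground P G av) (hreg : bg'.reg = bg.reg) (M₁ : ℕ) (Z : Set (Site P 0))
    (k : ℕ) {Vk : GaugeField P k G} (hdom : avgFamily av (qsstarGIter0 k Vk) ∈ bg.dom (Bj M₁ Z k))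
    (hdom' : avgFamily av (qsstarGIter0 k Vk) ∈ bg'.dom (Bj M₁ Z k)) :
    fun177std bg M₁ Z k Vk = fun177std bg' M₁ Z k Vk := by
  have h' : IsMinimizer av bg.reg (Bj M₁ Z k) (avgFamily av (qsstarGIter0 k Vk)) (bg'.U (Bj M₁ Z k) (avgFamily av (qsstarGIter0 k Vk))) := by
    rw [← hreg]
    exact bg'.isMinimizer _ _ hdom'
  exact fun177std_eq_wilsonAction4_of_isMinimizer bg M₁ Z k hdom h'

end Generic

/-! ## §2  NODE 00's totalised solution map of record `Node00.bgOfRecord av reg` -/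

section OfRecord

variable [MeasurableSpace G] (av : ∀ j, Averaging P j G) (reg : Set (GaugeField P 0 G))

/-- At NODE 00's solution map of record the domain is the solvable set, so ANY minimiser `U′` of the datum puts the datum in the domain and
`fun177 (bgOfRecord av reg) 𝔹 Q^{s} V_k = A(U′)`. [cite: Balaban1989LargeFieldI, (1.77) p.194; Balaban1988Convergent, (2.12) p.256] -/
theorem fun177_bgOfRecord_eq_wilsonAction4_of_isMinimizer {k : ℕ} (BkZ : DetSet P) (Qs : GaugeField P k G → GaugeField P 0 G)
    {Vk : GaugeField P k G} {U' : GaugeField P 0 G} (hU' : IsMinimizer av reg BkZ (avgFamily av (Qs Vk)) U') :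
    fun177 (bgOfRecord av reg) BkZ Qs Vk = wilsonAction4 U' :=
  fun177_eq_wilsonAction4_of_isMinimizer (bgOfRecord av reg) BkZ Qs ((mem_solvableDom_iff av reg BkZ _).2 ⟨U', hU'⟩) hU'

/-- ★ **(1.77) AT THE SOLUTION MAP OF RECORD IS THE ACTION OF ANY MINIMISER**: `fun177std (bgOfRecord av reg) M₁ Z k V_k = A(U′)` for every
minimal configuration `U′` of the (2.12) problem for `(𝐁_k(Z), M˙(Q_k^{s*}V_k))` in the class `reg` — no domain hypothesis (the datum is solvable by
`U′`). [cite: Balaban1989LargeFieldI, (1.74) p.192, (1.77) p.194; Balaban1988Convergent, (2.12) p.256] -/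
theorem fun177std_bgOfRecord_eq_wilsonAction4_of_isMinimizer (M₁ : ℕ) (Z : Set (Site P 0)) (k : ℕ) {Vk : GaugeField P k G}
    {U' : GaugeField P 0 G} (hU' : IsMinimizer av reg (Bj M₁ Z k) (avgFamily av (qsstarGIter0 k Vk)) U') :
    fun177std (bgOfRecord av reg) M₁ Z k Vk = wilsonAction4 U' :=
  fun177_bgOfRecord_eq_wilsonAction4_of_isMinimizer av reg (Bj M₁ Z k) (qsstarGIter0 k) hU'

/-- **THE JUNK BRANCH, LOCATED**: if the (2.12) problem for `(𝐁_k(Z), M˙(Q_k^{s*}V_k))` has NO minimal configuration in `reg`, the totalised map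
returns the unit configuration and (1.77) at the record takes the value `A(1) = 0` (typing convention of `Node00.UminOfRecord`; print poses (1.77)
only on regular data, [IV] p. 194 *«It is defined on configurations V_k satisfying mild regularity conditions»*). [cite: Balaban1989LargeFieldI, (1.77) p.194; Balaban1988Convergent, (2.12) p.256 (typing convention)] -/
theorem fun177std_bgOfRecord_of_not_solvable (M₁ : ℕ) (Z : Set (Site P 0)) (k : ℕ) {Vk : GaugeField P k G}
    (h : ¬ ∃ U₀, IsMinimizer av reg (Bj M₁ Z k) (avgFamily av (qsstarGIter0 k Vk)) U₀) :
    fun177std (bgOfRecord av reg) M₁ Z k Vk = 0 := by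
  rw [fun177std_eq, bgKZstd_apply, bgOfRecord_U, UminOfRecord_of_not av reg h]
  unfold wilsonAction4 wilsonAction
  refine Finset.sum_eq_zero fun p _ => ?_
  have hp : plaqHol (fun _ : PBond P 0 => (1 : G)) p = 1 := by simp [plaqHol]
  rw [hp, GaugeGroup.reTr_one, sub_self, mul_zero]

/-- (1.77) at the record is a function of the (2.12) PREDICATE of the datum: two fields `V_k, V_k′` whose data have the same minimal set (e.g. the
same datum) give the same value — on the solvable branch by §2's first theorem, on the junk branch both vanish. [cite: Balaban1989LargeFieldI, (1.77) p.194; Balaban1988Convergent, (2.12) p.256 (bookkeeping)] -/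
theorem fun177std_bgOfRecord_eq_of_isMinimizer_iff (M₁ : ℕ) (Z : Set (Site P 0)) (k : ℕ) {Vk Vk' : GaugeField P k G}
    (h : ∀ U₀, IsMinimizer av reg (Bj M₁ Z k) (avgFamily av (qsstarGIter0 k Vk)) U₀ ↔
      IsMinimizer av reg (Bj M₁ Z k) (avgFamily av (qsstarGIter0 k Vk')) U₀) :
    fun177std (bgOfRecord av reg) M₁ Z k Vk = fun177std (bgOfRecord av reg) M₁ Z k Vk' := by
  by_cases hs : ∃ U₀, IsMinimizer av reg (Bj M₁ Z k) (avgFamily av (qsstarGIter0 k Vk)) U₀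
  · obtain ⟨U₀, hU₀⟩ := hs
    rw [fun177std_bgOfRecord_eq_wilsonAction4_of_isMinimizer av reg M₁ Z k hU₀,
      fun177std_bgOfRecord_eq_wilsonAction4_of_isMinimizer av reg M₁ Z k ((h U₀).1 hU₀)]
  · have hs' : ¬ ∃ U₀, IsMinimizer av reg (Bj M₁ Z k) (avgFamily av (qsstarGIter0 k Vk')) U₀ :=
      fun ⟨U₀, hU₀⟩ => hs ⟨U₀, (h U₀).2 hU₀⟩
    rw [fun177std_bgOfRecord_of_not_solvable av reg M₁ Z k hs, fun177std_bgOfRecord_of_not_solvable av reg M₁ Z k hs']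

end OfRecord

/-! ## §3  NODE 00's (2.12) data of record on a support (`Node00.bgMSCoPOfRecordAt` ∕ `Node00.bgMSCoPOfRecord`), every `SU(N)` -/

section Record

variable {F : T4Continuum.T4Family} {N : ℕ} [NeZero N]

/-- ★ **(1.77) AT NODE 00's DATUM ON A SUPPORT IS THE ACTION OF ANY MINIMISER**: for the class `regMSCoPOfRecordAt F N ν K k Ω₀ Ω` ([15] (2) on the
support `Ω₀`) and any minimal configuration `U′` of the (2.12) problem for `(𝐁_{k′}(Z), M˙(Q_{k′}^{s*}V))` in that class,
`fun177std (bgMSCoPOfRecordAt F N ν K k Ω₀ Ω) M₁ Z k′ V = A(U′)`. [cite: Balaban1989LargeFieldI, (1.74) p.192, (1.77) p.194; Balaban1988Convergent, (2.12) p.256, p.255; Balaban1985Variational, (2) p.278] -/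
theorem fun177std_bgMSCoPOfRecordAt_eq_wilsonAction4_of_isMinimizer (ν : Stage7Numerics) (K k : ℕ) (Ω₀ : Set (Site (F.P K) 0))
    (Ω : ℕ → Set (Site (F.P K) 0)) (M₁ : ℕ) (Z : Set (Site (F.P K) 0)) (k' : ℕ) {V : GaugeField (F.P K) k' (SU N)}
    {U' : GaugeField (F.P K) 0 (SU N)}
    (hU' : IsMinimizer (avOfRecord F N K) (regMSCoPOfRecordAt F N ν K k Ω₀ Ω) (Bj M₁ Z k')
      (avgFamily (avOfRecord F N K) (qsstarGIter0 k' V)) U') :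
    fun177std (bgMSCoPOfRecordAt F N ν K k Ω₀ Ω) M₁ Z k' V = wilsonAction4 U' :=
  fun177std_bgOfRecord_eq_wilsonAction4_of_isMinimizer (avOfRecord F N K) (regMSCoPOfRecordAt F N ν K k Ω₀ Ω) M₁ Z k' hU'

/-- ★★ **(1.77) AT NODE 00's DATUM OF RECORD IS THE ACTION OF ANY MINIMISER** — the form the N12 endpoints read (`bg := bgMSCoPOfRecord F N ν K k Ω`,
the class `regMSCoPOfRecord F N ν K k Ω` on the support of record): `fun177std (bgMSCoPOfRecord F N ν K k Ω) M₁ Z k′ V = A(U′)` for every minimal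
configuration `U′` of the (2.12) problem for `(𝐁_{k′}(Z), M˙(Q_{k′}^{s*}V))` in that class.  This is the junction by which the INTRINSIC analytic
letter «some holomorphic family of minimisers» ([15] Prop. 9 (190)) yields the action-level letter (J1) of Proposition 1 [IV].
[cite: Balaban1989LargeFieldI, (1.74) p.192, (1.77) p.194, Prop. 1 p.194; Balaban1988Convergent, (2.12) p.256, p.255; Balaban1985Variational, (2) p.278, Prop. 9 (190) p.309] -/
theorem fun177std_bgMSCoPOfRecord_eq_wilsonAction4_of_isMinimizer (ν : Stage7Numerics) (K k : ℕ) (Ω : ℕ → Set (Site (F.P K) 0))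
    (M₁ : ℕ) (Z : Set (Site (F.P K) 0)) (k' : ℕ) {V : GaugeField (F.P K) k' (SU N)} {U' : GaugeField (F.P K) 0 (SU N)}
    (hU' : IsMinimizer (avOfRecord F N K) (regMSCoPOfRecord F N ν K k Ω) (Bj M₁ Z k')
      (avgFamily (avOfRecord F N K) (qsstarGIter0 k' V)) U') :
    fun177std (bgMSCoPOfRecord F N ν K k Ω) M₁ Z k' V = wilsonAction4 U' :=
  fun177std_bgOfRecord_eq_wilsonAction4_of_isMinimizer (avOfRecord F N K) (regMSCoPOfRecord F N ν K k Ω) M₁ Z k' hU'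

/-- The junk branch at the datum of record: no minimal configuration in the class of record ⇒ (1.77) vanishes there.
[cite: Balaban1989LargeFieldI, (1.77) p.194; Balaban1988Convergent, (2.12) p.256 (typing convention)] -/
theorem fun177std_bgMSCoPOfRecord_of_not_solvable (ν : Stage7Numerics) (K k : ℕ) (Ω : ℕ → Set (Site (F.P K) 0))
    (M₁ : ℕ) (Z : Set (Site (F.P K) 0)) (k' : ℕ) {V : GaugeField (F.P K) k' (SU N)}
    (h : ¬ ∃ U₀, IsMinimizer (avOfRecord F N K) (regMSCoPOfRecord F N ν K k Ω) (Bj M₁ Z k')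
      (avgFamily (avOfRecord F N K) (qsstarGIter0 k' V)) U₀) :
    fun177std (bgMSCoPOfRecord F N ν K k Ω) M₁ Z k' V = 0 :=
  fun177std_bgOfRecord_of_not_solvable (avOfRecord F N K) (regMSCoPOfRecord F N ν K k Ω) M₁ Z k' h

end Record

/-! ## §4  The letter bridge: a family of minimisers is a family of configurations carrying the value (1.77) -/

section Bridge

variable [MeasurableSpace G] (av : ∀ j, Averaging P j G) (reg : Set (GaugeField P 0 G))

/-- ★★ **FROM A MINIMISER FAMILY TO A VALUE FAMILY** (the shape in which the N12 endpoints consume a configuration-level letter): let `X` be any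
parameter type with a «real» part `S ⊆ X`, `cfg : X → (fields at step k)` a configuration family, `𝕄` any target with a reading `ρ : G → 𝕄` (e.g.
`SU(2) ↪ M₂(ℂ)`), and `Ũ : X → (bonds → 𝕄)` a family which at every `x ∈ S` reads SOME minimal configuration `U′` of the (2.12) problem for the
datum of `cfg x`.  Then at every `x ∈ S` it reads a configuration `U′` with `A(U′) = A(U_{k,Z}(cfg x))` (1.77) at NODE 00's solution map of record —
whatever analytic structure `Ũ` has on `X` is untouched, so «holomorphic family of minimisers» ⇒ «holomorphic family of configurations carrying the
value», the hypothesis from which (J1) is read off through the trace-polynomial Wilson action. [cite: Balaban1989LargeFieldI, (1.77) p.194, Prop. 1 p.194; Balaban1985Variational, Prop. 9 (190) p.309; Balaban1988Convergent, (2.12) p.256] -/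
theorem valueFamily_of_minimiserFamily {X 𝕄 : Type*} (S : Set X) (ρ : G → 𝕄) (M₁ : ℕ) (Z : Set (Site P 0)) (k : ℕ)
    (cfg : X → GaugeField P k G) (Ũ : X → PBond P 0 → 𝕄)
    (h : ∀ x ∈ S, ∃ U' : GaugeField P 0 G, (∀ b, Ũ x b = ρ (U' b)) ∧
      IsMinimizer av reg (Bj M₁ Z k) (avgFamily av (qsstarGIter0 k (cfg x))) U') :
    ∀ x ∈ S, ∃ U' : GaugeField P 0 G, (∀ b, Ũ x b = ρ (U' b)) ∧
      fun177std (bgOfRecord av reg) M₁ Z k (cfg x) = wilsonAction4 U' := fun x hx => by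
  obtain ⟨U', hŨ, hU'⟩ := h x hx
  exact ⟨U', hŨ, fun177std_bgOfRecord_eq_wilsonAction4_of_isMinimizer av reg M₁ Z k hU'⟩

/-- The same bridge with the solvability consequence displayed: a minimiser family over `S` puts every datum `M˙(Q_k^{s*}(cfg x))`, `x ∈ S`, in the
solvable set of record (the domain of `Node00.bgOfRecord`), i.e. [15] Thm 1's existence clause holds along the family. [cite: Balaban1985Variational, Thm 1 p.279; Balaban1988Convergent, (2.12) p.256] -/
theorem mem_solvableDom_of_minimiserFamily {X 𝕄 : Type*} (S : Set X) (ρ : G → 𝕄) (M₁ : ℕ) (Z : Set (Site P 0)) (k : ℕ)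
    (cfg : X → GaugeField P k G) (Ũ : X → PBond P 0 → 𝕄)
    (h : ∀ x ∈ S, ∃ U' : GaugeField P 0 G, (∀ b, Ũ x b = ρ (U' b)) ∧
      IsMinimizer av reg (Bj M₁ Z k) (avgFamily av (qsstarGIter0 k (cfg x))) U') :
    ∀ x ∈ S, avgFamily av (qsstarGIter0 k (cfg x)) ∈ (bgOfRecord av reg).dom (Bj M₁ Z k) := fun x hx => by
  obtain ⟨U', -, hU'⟩ := h x hx
  rw [bgOfRecord_dom]
  exact (mem_solvableDom_iff av reg _ _).2 ⟨U', hU'⟩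

end Bridge

end Literature.MathematicalPhysics.QuantumFieldTheory.Balaban1983to89.B15Prop1ValueOfAnyMinimiser

end
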